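import Summits.ResolutionOfSingularities.ResolutionOfSingularities.Theses.EquisingularLift
import Literature.AlgebraicGeometry.Motives.ProjectiveSpaceCells

/-!
# `EquisingularLift` — negative lemma: the hypothesis `IsIntegral H` is load-bearing (reducedness)

Support (negative) lemma for crux `stmt-ResolutionOfSingularities-15660`
(`Summit.ResolutionOfSingularities.ResolutionOfSingularities.Theses.EquisingularLift.EquisingularLift`),
filed by the standing disprover (cdisprove gen 1, cycle 1; work file `Cruxes/EquisingularLift/Disproof.lean`).
No definition is declared (the variant statement is displayed inline) and no theorem asserts a Theses
decl positively.

`equisingularLift_false_without_isIntegral`: the crux with the hypothesis `AlgebraicGeometry.IsIntegral H`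
DELETED (everything else verbatim) is FALSE. Witness: `p = 2`, `k = 𝔽₂^alg`, `n = 1`, and the double point
`H = Spec k[y]/(y²) ↪ 𝔸¹ = D₊(x₀) ⊆ ℙ¹_k` (supported at `[1 : 0]`): `ι` is a closed immersion (a closed
immersion into the chart followed by the open immersion of the chart, with closed image `V₊(x₁)`), its ideal
is locally principal (`(y²)` on `D₊(x₀)`, the unit ideal on `D₊(x₁)`), yet the conclusion provides an
isomorphism `V(𝓘_Y) ≅ H` from the REDUCED induced closed subscheme on a closed subset `Y`
(`isReduced_subscheme_vanishingIdeal`), so `H` would be reduced — but `y` is a non-zero nilpotent of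
`k[y]/(y²)`. Hence any proof of the crux must use the reducedness half of `IsIntegral H` (the iso
`(vanishingIdeal Y).subscheme ≅ H` forces it); irreducibility is a separate matter (a reduced reducible
`H`, e.g. two lines, is not excluded by this witness). Kernel-only (propext, Classical.choice, Quot.sound).
-/

noncomputable section

set_option linter.dupNamespace false

open CategoryTheory AlgebraicGeometry TopologicalSpace
open Literature.AlgebraicGeometry.Motives Literature.AlgebraicGeometry.Resolution

namespace Summit.ResolutionOfSingularities.ResolutionOfSingularities.Theorems.EquisingularLift.Negative

/-- The preimage of a principal ideal under a bijective ring homomorphism is principal. [folklore] -/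
theorem isPrincipal_comap_of_bijective {R S : Type*} [CommRing R] [CommRing S] (f : R →+* S)
    (hf : Function.Bijective f) {I : Ideal S} (hI : I.IsPrincipal) : (I.comap f).IsPrincipal := by
  obtain ⟨a, ha⟩ := hI
  let e : R ≃+* S := RingEquiv.ofBijective f hf
  have hea : f (e.symm a) = a := e.apply_symm_apply a
  refine ⟨⟨e.symm a, ?_⟩⟩
  ext x
  rw [ha]
  change f x ∈ Ideal.span {a} ↔ x ∈ Ideal.span {e.symm a}
  rw [Ideal.mem_span_singleton, Ideal.mem_span_singleton]
  constructor
  · rintro ⟨b, hb⟩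
    refine ⟨e.symm b, hf.1 ?_⟩
    rw [map_mul, hea, hb]
    exact congrArg _ (e.apply_symm_apply b).symm
  · rintro ⟨b, hb⟩
    exact ⟨f b, by rw [hb, map_mul, hea]⟩

/-- If `g` is injective then `ker (g ∘ f) = ker f`. [folklore] -/
theorem ker_comp_of_injective {R S T : Type*} [CommRing R] [CommRing S] [CommRing T]
    (f : R →+* S) (g : S →+* T) (hg : Function.Injective g) :
    RingHom.ker (g.comp f) = RingHom.ker f := by
  ext x
  simp only [RingHom.mem_ker, RingHom.coe_comp, Function.comp_apply, map_eq_zero_iff g hg]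

/-- **`IsIntegral H` is load-bearing in `EquisingularLift` (its reducedness half).** The displayed
statement is the crux `EquisingularLift.EquisingularLift` with the hypothesis `AlgebraicGeometry.IsIntegral H`
deleted, everything else verbatim; it is FALSE: for the double point `Spec k[y]/(y²) ↪ ℙ¹_k`
(`k = 𝔽₂^alg`, a closed immersion with locally principal ideal) the conclusion would give an isomorphism
with the reduced induced subscheme on a closed subset of `P`, which is reduced, while `y` is a non-zero
nilpotent. [folklore] -/
theorem equisingularLift_false_without_isIntegral : ¬ (∀ p : ℕ, p.Prime → ∀ (k : Type) [Field k] [CharP k p] [IsAlgClosed k] (n : ℕ) (H : AlgebraicGeometry.Scheme.{0}) (ι : H ⟶ (Literature.AlgebraicGeometry.Motives.projectiveSpace n k).left), AlgebraicGeometry.IsClosedImmersion ι → (∀ y : (Literature.AlgebraicGeometry.Motives.projectiveSpace n k).left, ∃ U : (Literature.AlgebraicGeometry.Motives.projectiveSpace n k).left.affineOpens, y ∈ (U : (Literature.AlgebraicGeometry.Motives.projectiveSpace n k).left.Opens) ∧ (ι.ker.ideal U).IsPrincipal) → ∃ (O : Type) (_ : CommRing O) (_ : IsDomain O) (_ : IsDiscreteValuationRing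 O) (_ : CharZero O) (P P' : AlgebraicGeometry.Scheme.{0}) (q : P ⟶ AlgebraicGeometry.Spec (.of O)) (Y : TopologicalSpace.Closeds P) (σ : P' ⟶ P) (S' : Set P'), AlgebraicGeometry.Smooth q ∧ AlgebraicGeometry.IsProper q ∧ (Y : Set P) ⊆ q ⁻¹' {IsLocalRing.closedPoint O} ∧ Nonempty ((AlgebraicGeometry.Scheme.IdealSheafData.vanishingIdeal Y).subscheme ≅ H) ∧ (∀ Q : (∀ X' : AlgebraicGeometry.Scheme.{0}, (X' ⟶ P) → Set X' → Prop), Q P (CategoryTheory.CategoryStruct.id P) (Y : Set P) → (∀ (X' X'' : AlgebraicGeometry.Scheme.{0}) (σ' : X' ⟶ P) (Y' : Set X') (C : X'.IdealSheafData) (τ : X'' ⟶ X'), Q X' σ' Y' → Literature.AlgebraicGeometry.Resolution.IsBlowup τ C → Literature.AlgebraicGeometry.Resolution.Scheme.IsRegular C.subscheme → σ' '' (C.support : Set X') ⊆ {x : P | ¬ IsGenericPoint x (Y : Set P)} → Q X'' (CategoryTheory.CategoryStruct.comp τ σ') (closure (τ ⁻¹' (Y' \ (C.support : Set X'))))) →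 Q P' σ S') ∧ IsIrreducible ((CategoryTheory.CategoryStruct.comp σ q) ⁻¹' {IsLocalRing.closedPoint O}) ∧ Literature.AlgebraicGeometry.Resolution.Scheme.IsRegular (AlgebraicGeometry.Scheme.IdealSheafData.vanishingIdeal (⟨closure S', isClosed_closure⟩ : TopologicalSpace.Closeds P')).subscheme) := by
  intro hEL
  -- the witness: the double point `Spec k[y]/(y²)` inside the chart `D₊(x₀) ≅ 𝔸¹` of `ℙ¹_k`
  let k : Type := AlgebraicClosure (ZMod 2)
  letI : GradedAlgebra (MvPolynomial.homogeneousSubmodule (Fin (1 + 1)) k) :=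
    MvPolynomial.gradedAlgebra
  let R : Type := MvPolynomial (Fin 1) k
  let A : Type := R ⧸ Ideal.span {(MvPolynomial.X 0 : R) ^ 2}
  let qA : R →+* A := Ideal.Quotient.mk _
  let H : Scheme.{0} := Spec (CommRingCat.of A)
  let j : H ⟶ Spec (CommRingCat.of R) := Spec.map (CommRingCat.ofHom qA)
  let c : Spec (CommRingCat.of R) ⟶ (projectiveSpace 1 k).left := ProjectiveSpaceCells.chartι k 1 0
  let ι : H ⟶ (projectiveSpace 1 k).left := j ≫ c
  haveI hjci : IsClosedImmersion j :=
    IsClosedImmersion.spec_of_surjective (CommRingCat.ofHom qA) fun b => Ideal.Quotient.mk_surjective b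
  haveI : IsOpenImmersion c := ProjectiveSpaceCells.isOpenImmersion_chartι k 1 0
  -- the image of `j` is `V(y)`
  have hrange_j : Set.range j = PrimeSpectrum.zeroLocus {(MvPolynomial.X 0 : R)} := by
    have h1 : Set.range j = Set.range (PrimeSpectrum.comap qA) := by
      ext x
      simp only [Set.mem_range]
      rfl
    rw [h1, range_comap_of_surjective (f := qA) (hf := Ideal.Quotient.mk_surjective), Ideal.mk_ker,
      PrimeSpectrum.zeroLocus_span, PrimeSpectrum.zeroLocus_singleton_pow _ 2 two_pos]
  -- `V₊(x₁) ⊆ D₊(x₀)`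
  have hVD : ∀ y : ↥(projectiveSpace 1 k).left, y ∈ ProjectiveSpectrum.zeroLocus
      (MvPolynomial.homogeneousSubmodule (Fin (1 + 1)) k) {(MvPolynomial.X 1 : MvPolynomial (Fin (1 + 1)) k)} →
      y ∈ Proj.basicOpen (MvPolynomial.homogeneousSubmodule (Fin (1 + 1)) k)
        (MvPolynomial.X 0 : MvPolynomial (Fin (1 + 1)) k) := by
    intro y hy
    have hy' : (MvPolynomial.X 1 : MvPolynomial (Fin (1 + 1)) k) ∈ y.asHomogeneousIdeal :=
      Set.singleton_subset_iff.mp ((ProjectiveSpectrum.mem_zeroLocus _ _ _).mp hy)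
    refine (Proj.mem_basicOpen _ _ _).mpr fun h0 => ?_
    have hall : ∀ i : Fin (1 + 1), (MvPolynomial.X i : MvPolynomial (Fin (1 + 1)) k) ∈
        y.asHomogeneousIdeal := by
      intro i
      fin_cases i
      · exact h0
      · exact hy'
    refine y.not_irrelevant_le fun a ha => ?_
    exact Ideal.span_le.mpr (Set.range_subset_iff.mpr hall) (ProjectiveSpace.irrelevant_le_span 1 k ha)
  -- `D₊(x₀) ∩ V₊(x₁)` in the chart is `V(y)`
  have h2 := ProjectiveSpaceCells.chartι_preimage_zeroLocus_X k 1 (0 : Fin 2) (0 : Fin 1)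
  have h01 : (0 : Fin 2).succAbove (0 : Fin 1) = 1 := by decide
  rw [h01] at h2
  -- the image of `ι` is `V₊(x₁)`, closed
  have hrangeι : Set.range ι = ProjectiveSpectrum.zeroLocus
      (MvPolynomial.homogeneousSubmodule (Fin (1 + 1)) k) {(MvPolynomial.X 1 : MvPolynomial (Fin (1 + 1)) k)} := by
    ext y
    constructor
    · rintro ⟨x, rfl⟩
      have hjx : j x ∈ PrimeSpectrum.zeroLocus {(MvPolynomial.X 0 : R)} := hrange_j ▸ Set.mem_range_self x
      rw [← h2] at hjx
      rw [Scheme.Hom.comp_apply]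
      exact hjx
    · intro hy
      have hyD : y ∈ Set.range (ProjectiveSpaceCells.chartι k 1 0).base := by
        rw [ProjectiveSpaceCells.range_chartι]
        exact hVD y hy
      obtain ⟨z, rfl⟩ := hyD
      have hz : z ∈ PrimeSpectrum.zeroLocus {(MvPolynomial.X 0 : R)} := by
        rw [← h2]
        exact hy
      rw [← hrange_j] at hz
      obtain ⟨x, rfl⟩ := hz
      exact ⟨x, Scheme.Hom.comp_apply j c x⟩
  haveI hι : IsClosedImmersion ι := by
    refine IsClosedImmersion.of_isPreimmersion ι ?_
    rw [hrangeι]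
    exact ProjectiveSpectrum.isClosed_zeroLocus _ _
  -- the ideal of `ι` is locally principal
  have hloc : ∀ y : ↥(projectiveSpace 1 k).left, ∃ U : (projectiveSpace 1 k).left.affineOpens,
      y ∈ (U : (projectiveSpace 1 k).left.Opens) ∧ (ι.ker.ideal U).IsPrincipal := by
    intro y
    by_cases hy : y ∈ c.opensRange
    · -- over the chart `D₊(x₀)`: the ideal is `(y²)`, read through `Γ(D₊(x₀)) ≅ k[y]`
      let W : (Spec (CommRingCat.of R)).affineOpens := ⟨⊤, isAffineOpen_top _⟩
      refine ⟨⟨c ''ᵁ (W : (Spec (CommRingCat.of R)).Opens), W.2.image_of_isOpenImmersion c⟩, ?_, ?_⟩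
      · change y ∈ c ''ᵁ ⊤
        rwa [Scheme.Hom.image_top_eq_opensRange]
      · have hsq : IsPullback j (𝟙 H) c ι :=
          IsPullback.of_vert_isIso_mono ⟨(Category.id_comp (j ≫ c)).symm⟩
        have key := Scheme.ker_ideal_of_isPullback_of_isOpenImmersion ι j (𝟙 H) c hsq W
        have key2 : ι.ker.ideal ⟨c ''ᵁ (W : (Spec (CommRingCat.of R)).Opens),
            W.2.image_of_isOpenImmersion c⟩ = (j.ker.ideal W).comap (c.appIso W).hom.hom := by
          rw [key, Ideal.comap_comap, ← CommRingCat.hom_comp, Iso.hom_inv_id, CommRingCat.hom_id,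
            Ideal.comap_id]
        rw [key2]
        refine isPrincipal_comap_of_bijective _
          (ConcreteCategory.bijective_of_isIso (c.appIso W).hom) ?_
        rw [Scheme.Hom.ker_apply]
        change (RingHom.ker (j.appTop).hom).IsPrincipal
        have happ : j.appTop = (Scheme.ΓSpecIso (CommRingCat.of R)).hom ≫ CommRingCat.ofHom qA ≫
            (Scheme.ΓSpecIso (CommRingCat.of A)).inv := by
          rw [← Scheme.ΓSpecIso_naturality_assoc (CommRingCat.ofHom qA), Iso.hom_inv_id,
            Category.comp_id]
        rw [happ, CommRingCat.hom_comp, CommRingCat.hom_comp, ← RingHom.comap_ker,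
          ker_comp_of_injective _ _
            (ConcreteCategory.bijective_of_isIso (Scheme.ΓSpecIso (CommRingCat.of A)).inv).1]
        refine isPrincipal_comap_of_bijective _
          (ConcreteCategory.bijective_of_isIso (Scheme.ΓSpecIso (CommRingCat.of R)).hom) ?_
        change (RingHom.ker qA).IsPrincipal
        rw [Ideal.mk_ker]
        exact ⟨⟨(MvPolynomial.X 0 : R) ^ 2, rfl⟩⟩
    · -- away from `[1 : 0]`: on `D₊(x₁)` the ideal is the unit ideal
      have hy0 : (MvPolynomial.X 0 : MvPolynomial (Fin (1 + 1)) k) ∈ y.asHomogeneousIdeal := by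
        have : y ∉ Proj.basicOpen (MvPolynomial.homogeneousSubmodule (Fin (1 + 1)) k)
            (MvPolynomial.X 0 : MvPolynomial (Fin (1 + 1)) k) := by
          rwa [← ProjectiveSpaceCells.opensRange_chartι k 1 0]
        exact not_not.mp ((Proj.mem_basicOpen _ _ _).not.mp this)
      have hy1 : (MvPolynomial.X 1 : MvPolynomial (Fin (1 + 1)) k) ∉ y.asHomogeneousIdeal := by
        intro h1
        have hall : ∀ i : Fin (1 + 1), (MvPolynomial.X i : MvPolynomial (Fin (1 + 1)) k) ∈
            y.asHomogeneousIdeal := by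
          intro i
          fin_cases i
          · exact hy0
          · exact h1
        refine y.not_irrelevant_le fun a ha => ?_
        exact Ideal.span_le.mpr (Set.range_subset_iff.mpr hall)
          (ProjectiveSpace.irrelevant_le_span 1 k ha)
      let U1 : (projectiveSpace 1 k).left.affineOpens :=
        ProjSubscheme.affineBasicOpen (MvPolynomial.homogeneousSubmodule (Fin (1 + 1)) k)
          (MvPolynomial.X 1 : MvPolynomial (Fin (1 + 1)) k) (ProjectiveSpace.X_mem 1) zero_lt_one
      refine ⟨U1, ?_, ?_⟩
      · exact (Proj.mem_basicOpen _ _ _).mpr hy1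
      · have hpre : ι ⁻¹ᵁ (U1 : (projectiveSpace 1 k).left.Opens) = ⊥ := by
          ext x
          simp only [TopologicalSpace.Opens.coe_bot, Set.mem_empty_iff_false, iff_false]
          intro hx
          have hmem : ι x ∈ ProjectiveSpectrum.zeroLocus
              (MvPolynomial.homogeneousSubmodule (Fin (1 + 1)) k)
              {(MvPolynomial.X 1 : MvPolynomial (Fin (1 + 1)) k)} := hrangeι ▸ Set.mem_range_self x
          have hmem' : (MvPolynomial.X 1 : MvPolynomial (Fin (1 + 1)) k) ∈ (ι x).asHomogeneousIdeal :=
            Set.singleton_subset_iff.mp ((ProjectiveSpectrum.mem_zeroLocus _ _ _).mp hmem)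
          have hx' : ι x ∈ Proj.basicOpen (MvPolynomial.homogeneousSubmodule (Fin (1 + 1)) k)
              (MvPolynomial.X 1 : MvPolynomial (Fin (1 + 1)) k) := hx
          exact (Proj.mem_basicOpen _ _ _).mp hx' hmem'
        haveI : Subsingleton Γ(H, ι ⁻¹ᵁ (U1 : (projectiveSpace 1 k).left.Opens)) := by
          rw [hpre]
          infer_instance
        rw [Scheme.Hom.ker_apply]
        have htop : RingHom.ker (ι.app (U1 : (projectiveSpace 1 k).left.Opens)).hom = ⊤ := by
          rw [eq_top_iff]
          intro s _
          rw [RingHom.mem_ker]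
          exact Subsingleton.elim _ _
        rw [htop]
        exact ⟨⟨1, Ideal.span_singleton_one.symm⟩⟩
  -- apply the variant statement and read off reducedness of `H`
  obtain ⟨O, _, _, _, _, P, P', qq, Y, σ, S', -, -, -, ⟨e⟩, -, -, -⟩ := hEL 2 Nat.prime_two k 1 H ι hι hloc
  haveI := ComponentGluing.isReduced_subscheme_vanishingIdeal Y
  haveI : AlgebraicGeometry.IsReduced H := isReduced_of_isOpenImmersion e.inv
  have hred : _root_.IsReduced A := (affine_isReduced_iff (CommRingCat.of A)).mp inferInstance
  -- but `y` is a non-zero nilpotent of `k[y]/(y²)`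
  have hnil : IsNilpotent (qA (MvPolynomial.X 0)) := by
    refine ⟨2, ?_⟩
    rw [← map_pow, Ideal.Quotient.eq_zero_iff_mem]
    exact Ideal.subset_span rfl
  have h0 : qA (MvPolynomial.X 0) = 0 := hnil.eq_zero
  rw [Ideal.Quotient.eq_zero_iff_mem, Ideal.mem_span_singleton] at h0
  obtain ⟨r, hr⟩ := h0
  have hX : (MvPolynomial.X 0 : R) ≠ 0 := MvPolynomial.X_ne_zero 0
  have h1 : (MvPolynomial.X 0 : R) * 1 = MvPolynomial.X 0 * (MvPolynomial.X 0 * r) := by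
    rw [mul_one, ← mul_assoc, ← pow_two]
    exact hr
  have h3 := congrArg (MvPolynomial.eval fun _ => (0 : k)) (mul_left_cancel₀ hX h1)
  simp at h3

end Summit.ResolutionOfSingularities.ResolutionOfSingularities.Theorems.EquisingularLift.Negative

end
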